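import Literature.NumberTheory.EllipticCurves.HeegnerPointsOfConductorRationality
import Mathlib.FieldTheory.Fixed
import HarnessLib

/-!
# Route `KolyvaginRoadThree` — seam G-a AT EVERY LEVEL: Kolyvagin–Heegner data EXIST at every square-free inert
# level (`Nonempty (KolyvaginHeegnerData Dt β ι n)` from Gross 1991 §3; `--supports stmt-BirchSwinnertonDyer-19153`)

Cell `bsd-stepL` (run/shared/lean/pub/bsd-stepL/), seat `bsd-stepL-koly` (prover, Kolyvagin road); answers
zhang3-p1's recommendation (i) (STATUS 2026-08-26T03:40:27Z). zhang3-p1 proved (p418676 + p420076) that the deciding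
crux `Theses.KolyvaginRoadThree.ZhangSharpFrameAtThree` is EQUIVALENT to its TOWER POINT FORM («at every Manin-good
conductor-1 frame some tower of Kolyvagin–Heegner data `d m (m ∣ n)` over a level `n ∈ Λ₃` has `3 ∤ P(n)` in
`E(K[n])`») MODULO the hypothesis shape `hKD` of `KolyCert.towerCertificates_of_zhangSharpFrameAtThree`: for `K`
imaginary quadratic Heegner for `N_E`, every frame `(Dt, β, ι)` with `4N ∣ β² − d_K` and every square-free `m`
whose prime factors are inert in `K`, a datum `KolyvaginHeegnerData Dt β ι m` EXISTS. Of the datum's fields two are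
CM theory — `y = y(m) ∈ E(K[m])` (*"the point `x_m` is rational over `K_m`"*) and the generators `σ_ℓ` of the CYCLIC
groups `G_ℓ = Gal(K[m]/K[m/ℓ])` — now the tree's NAMED facts `phi_heegnerPointOfConductor_mem_range_map_ringClassField`
and `exists_generator_ringClassGalOver` (`HeegnerPointsOfConductorRationality.lean`, Gross 1991 §3); the others are
algebra: `S` = a transversal of `G_m = Gal(K[m]/K[1])` in `𝒢_m = Gal(K[m]/K)` (representatives `Quotient.out` of the
cosets of the finite group `Aut(K[m])`), `emb = IsAlgClosed.lift : K[m] →ₐ[K] K̄`.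

Contents (THEOREMS ONLY; no definition, no named fact, no `sorry`):
* `ncard_primesOver_eq_one_of_isPrime_span`, `coprime_of_primeFactors_inert` — an inert prime is not split, so
  under the Heegner hypothesis a product of inert primes is prime to `N` (Gross (3.1)–(3.2));
* `nonempty_kolyvaginHeegnerData_of_grossCM` — **the datum at square-free inert level `n` from the two named facts**;
* `kolyvaginRoadThree_towerData_of_grossCM` — zhang3-p1's `hKD` shape VERBATIM from `∀ N W K` the two facts;
* (sequel `Theorems/KolyvaginRoadThreeTowerFormGross.lean`: `towerCertificates_of_zhangSharpFrameAtThree_of_grossCM`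
  — hence crux ⟹ tower point form modulo the two published facts only; with p418676's converse: crux ⟺ tower
  point form.)
HONEST FRAMING: structural; the crux is untouched; no class of atom O2@3 moves (PARTITION: O2@3 × A1 (1 116
TRUE-OPEN; cw 248 943) — types-the-object-of; closes: none).

References: [GrossLMS1991] B. H. Gross, *Kolyvagin's work on modular elliptic curves*, LMS LNS 153 (1991), §3
(pp. 238–239), §4 (4.1); [Darmon2004] H. Darmon, CBMS 101 (2004), Thm. 3.6; [Cox2013] D. A. Cox, Thm. 7.24, 11.1.
-/

noncomputable section

open scoped Classical

universe u

namespace Summit.BirchSwinnertonDyer.BirchSwinnertonDyer.Theorems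

open WeierstrassCurve NumberField Literature.NumberTheory.EllipticCurves
  Literature.NumberTheory.EllipticCurves.ModularForms

/-! ## §1 Inert primes are prime to the level under the Heegner hypothesis -/

/-- If `(q)` is a prime ideal of `𝓞 K` (`q` a rational prime INERT in `K`), then `(q)` is the only prime of `𝓞 K`
over `qℤ`: the set of primes over `qℤ` has exactly one element. [folklore] -/
theorem ncard_primesOver_eq_one_of_isPrime_span {K : Type u} [Field K] [NumberField K] {q : ℕ} (hq : q.Prime)
    (hP : (Ideal.span {(q : 𝓞 K)}).IsPrime) :
    ((Ideal.span {(q : ℤ)}).primesOver (𝓞 K)).ncard = 1 := by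
  set Q : Ideal (𝓞 K) := Ideal.span {(q : 𝓞 K)} with hQ_def
  have hQne : Q ≠ ⊥ := by
    rw [hQ_def, Ne, Ideal.span_singleton_eq_bot]
    exact_mod_cast hq.ne_zero
  have hmax : Q.IsMaximal := hP.isMaximal hQne
  have hunder : Ideal.span {(q : ℤ)} = Q.under ℤ := by
    have hle : Ideal.span {(q : ℤ)} ≤ Q.under ℤ := by
      rw [Ideal.span_le, Set.singleton_subset_iff]
      show algebraMap ℤ (𝓞 K) q ∈ Q
      rw [map_natCast]
      exact Ideal.subset_span rfl
    have hqmax : (Ideal.span {(q : ℤ)}).IsMaximal :=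
      PrincipalIdealRing.isMaximal_of_irreducible (Nat.prime_iff_prime_int.mp hq).irreducible
    exact hqmax.eq_of_le (Ideal.IsPrime.under ℤ Q).ne_top hle
  have hset : (Ideal.span {(q : ℤ)}).primesOver (𝓞 K) = {Q} := by
    ext P
    simp only [Set.mem_singleton_iff]
    constructor
    · rintro ⟨hPp, hover⟩
      have hle : Q ≤ P := by
        rw [hQ_def, Ideal.span_le, Set.singleton_subset_iff]
        have hmem : (q : ℤ) ∈ P.under ℤ := by
          rw [← hover.over]; exact Ideal.subset_span rfl
        have := Ideal.mem_comap.mp hmem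
        simpa using this
      exact (hmax.eq_of_le hPp.ne_top hle).symm
    · intro h
      subst h
      exact ⟨hP, ⟨hunder⟩⟩
  rw [hset, Set.ncard_singleton]

/-- Under the Heegner hypothesis for `N` (every prime factor of `N` SPLITS in `K`), an integer all of whose prime
factors are INERT in `K` is prime to `N` (Gross 1991, (3.1)–(3.2)). [cite: GrossLMS1991, §3 (3.1)–(3.2)] -/
theorem coprime_of_primeFactors_inert {K : Type u} [Field K] [NumberField K] {N n : ℕ}
    (hH : SatisfiesHeegnerHypothesis N K) (hn : n ≠ 0)
    (hinert : ∀ q ∈ n.primeFactors, (Ideal.span {(q : 𝓞 K)}).IsPrime) : Nat.Coprime n N := by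
  refine Nat.coprime_of_dvd fun q hq hqn hqN ↦ ?_
  have hmem : q ∈ n.primeFactors := Nat.mem_primeFactors.mpr ⟨hq, hqn, hn⟩
  have h1 := ncard_primesOver_eq_one_of_isPrime_span hq (hinert q hmem)
  have h2 := hH q hq hqN
  omega

/-! ## §2 The datum at a square-free inert level from the two named facts -/

variable {K : Type u} [Field K] [NumberField K] {N : ℕ} [NeZero N] {W : WeierstrassCurve ℚ}

/-- **Kolyvagin–Heegner data EXIST at every square-free level whose prime factors are inert in `K`**, granted the
two CM facts of Gross 1991 §3 (named facts, hypotheses here): `y(n) = φ(x(n)) ∈ E(K[n])`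
(`phi_heegnerPointOfConductor_mem_range_map_ringClassField N W K`) and the cyclicity of each
`G_ℓ = Gal(K[n]/K[n/ℓ])` (`exists_generator_ringClassGalOver K`). The remaining fields are constructed:
`S` := the representatives `Quotient.out` of the cosets of `G_n = Gal(K[n]/K[1])` in `Aut(K[n])` that lie in
`𝒢_n = Gal(K[n]/K)` (a transversal: `K[n]/ℚ` is finite, `finiteDimensional_and_isGalois_ringClassField`);
`emb := IsAlgClosed.lift : K[n] →ₐ[K] K̄`. For `E/ℚ` elliptic, `K` imaginary quadratic Heegner for `N`, any frame
`(Dt, β, ι)` with `4N ∣ β² − d_K`. (Gross 1991 §3–§4: *"Let `σ_ℓ` be a fixed generator of `G_ℓ` … Let `S` be a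
set of coset representatives for `G_n` in `𝒢_n`"*.) CONDITIONAL on the two named facts only.
[cite: GrossLMS1991, §3 (pp. 238–239) and §4 (4.1)] -/
theorem nonempty_kolyvaginHeegnerData_of_grossCM [W.IsElliptic]
    (h1 : phi_heegnerPointOfConductor_mem_range_map_ringClassField N W K)
    (h2 : exists_generator_ringClassGalOver K)
    (hK : IsImaginaryQuadratic K) (hH : SatisfiesHeegnerHypothesis N K)
    (Dt : ModularParametrizationData W N) (β : ℤ) (ι : K →+* ℂ)
    (hβ : (4 * N : ℤ) ∣ β ^ 2 - NumberField.discr K) {n : ℕ} (hn : Squarefree n)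
    (hinert : ∀ q ∈ n.primeFactors, (Ideal.span {(q : 𝓞 K)}).IsPrime) :
    Nonempty (KolyvaginHeegnerData Dt β ι n) := by
  have hn0 : n ≠ 0 := hn.ne_zero
  have hcop : Nat.Coprime n N := coprime_of_primeFactors_inert hH hn0 hinert
  -- `K[n]/ℚ` is finite: `Aut(K[n])` is finite and `K[n]/K` is algebraic
  obtain ⟨hfd, -⟩ := finiteDimensional_and_isGalois_ringClassField hK ι hn0
  haveI := hfd
  haveI : FiniteDimensional ℚ (ringClassField K ι n) := Module.Finite.trans K (ringClassField K ι n)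
  haveI : Algebra.IsAlgebraic K (ringClassField K ι n) := Algebra.IsAlgebraic.of_finite K _
  -- the embedding `K[n] → K̄` over `K`
  let e : ringClassField K ι n →ₐ[K] AlgebraicClosure K := IsAlgClosed.lift
  -- the point `y(n) ∈ E(K[n])` (first named fact)
  obtain ⟨P, hP⟩ := h1 hK hH Dt β ι n hβ hn0 hcop
  -- the generators `σ_ℓ` (second named fact)
  have hgen : ∀ ℓ ∈ n.primeFactors, ∃ σ : ringClassField K ι n ≃ₐ[ℚ] ringClassField K ι n,
      Subgroup.zpowers σ = ringClassGalOver ι n (n / ℓ) := fun ℓ hℓ ↦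
    h2 hK ι n ℓ hn (Nat.prime_of_mem_primeFactors hℓ) (Nat.dvd_of_mem_primeFactors hℓ) (hinert ℓ hℓ)
  choose! σ hσ using hgen
  -- the transversal `S` of `G_n = Gal(K[n]/K[1])` in `𝒢_n = Gal(K[n]/K)`
  set H := ringClassGalOver ι n 1 with hH_def
  haveI : Finite (_ ⧸ H) := Finite.of_surjective _ (QuotientGroup.mk_surjective (s := H))
  haveI : Fintype (_ ⧸ H) := Fintype.ofFinite _
  let S : Finset (ringClassField K ι n ≃ₐ[ℚ] ringClassField K ι n) :=
    ((Finset.univ : Finset (_ ⧸ H)).image Quotient.out).filter (· ∈ ringClassGal ι n)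
  refine ⟨{ dvd_sq_sub := hβ
            y := P
            map_y := hP
            σ := σ
            zpowers_σ := hσ
            S := S
            S_subset := fun s hs ↦ (Finset.mem_filter.mp hs).2
            S_transversal := ?_
            emb := e.toRingHom
            emb_apply := fun k ↦ e.commutes k }⟩
  intro g hg
  have hHle : H ≤ ringClassGal ι n := ringClassGalOver_le_ringClassGal ι n 1
  -- the representative of the coset `gH`
  set s₀ := ((g : _ ⧸ H)).out with hs₀_def
  have hs₀H : g⁻¹ * s₀ ∈ H := QuotientGroup.eq.mp (QuotientGroup.out_eq' (g : _ ⧸ H)).symm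
  have hs₀G : s₀ ∈ ringClassGal ι n := by
    have : s₀ = g * (g⁻¹ * s₀) := by group
    rw [this]
    exact Subgroup.mul_mem _ hg (hHle hs₀H)
  have hs₀S : s₀ ∈ S :=
    Finset.mem_filter.mpr ⟨Finset.mem_image.mpr ⟨(g : _ ⧸ H), Finset.mem_univ _, rfl⟩, hs₀G⟩
  refine ⟨s₀, ⟨hs₀S, hs₀H⟩, ?_⟩
  rintro s ⟨hsS, hsH⟩
  obtain ⟨q, -, rfl⟩ := Finset.mem_image.mp (Finset.mem_filter.mp hsS).1
  have hgq : (g : _ ⧸ H) = q := by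
    rw [← QuotientGroup.out_eq' q]
    exact QuotientGroup.eq.mpr hsH
  rw [hs₀_def, hgq]

/-! ## §3 The route's hypothesis shapes -/

/-- **zhang3-p1's `hKD` (hypothesis of `KolyCert.towerCertificates_of_zhangSharpFrameAtThree`, p420076) VERBATIM
from the two named facts of Gross 1991 §3** at every `(N, W, K)`: on every admissible frame of an imaginary quadratic
Heegner field and every square-free level with inert prime factors, a Kolyvagin–Heegner datum exists.
[cite: GrossLMS1991, §3 (pp. 238–239)] -/
theorem kolyvaginRoadThree_towerData_of_grossCM
    (h1 : ∀ (N : ℕ) [NeZero N] (W : WeierstrassCurve ℚ) (K : Type) [Field K] [NumberField K],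
      phi_heegnerPointOfConductor_mem_range_map_ringClassField N W K)
    (h2 : ∀ (K : Type) [Field K] [NumberField K], exists_generator_ringClassGalOver K) :
    ∀ (W : WeierstrassCurve ℚ) [W.IsElliptic] [W.IsGloballyMinimal] [NeZero (W.conductorNorm ℤ)]
      (K : Type) [Field K] [NumberField K]
      (Dt : ModularParametrizationData W (W.conductorNorm ℤ)) (β : ℤ) (ι : K →+* ℂ) (m : ℕ),
      IsImaginaryQuadratic K → SatisfiesHeegnerHypothesis (W.conductorNorm ℤ) K →
      (4 * (W.conductorNorm ℤ : ℤ)) ∣ β ^ 2 - NumberField.discr K → Squarefree m →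
      (∀ q ∈ m.primeFactors, (Ideal.span {(q : 𝓞 K)}).IsPrime) →
      Nonempty (KolyvaginHeegnerData Dt β ι m) :=
  fun W _ _ _ K _ _ Dt β ι _ hK hH hβ hm hinert ↦
    nonempty_kolyvaginHeegnerData_of_grossCM (h1 _ W K) (h2 K) hK hH Dt β ι hβ hm hinert

end Summit.BirchSwinnertonDyer.BirchSwinnertonDyer.Theorems
end
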